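import Mathlib
import HarnessLib
import Literature.AlgebraicGeometry.Resolution.MvPolynomialKillVars
import Literature.AlgebraicGeometry.Resolution.RegularCentreLocal
import Summits.ResolutionOfSingularities.ResolutionOfSingularities.Theorems.WildQuotientsWildQuotientResolutionS1aAuxCover
import Summits.ResolutionOfSingularities.ResolutionOfSingularities.Theorems.WildQuotientsWildQuotientResolutionS1aNodeTransport

/-!
# S1a — X-scheme MOVE producer on a MODEL NODE: an admissible centre cut out by VARIABLES of a free model `k[T_ι][1/h]` of a chart's node

[OURS · L1 W4.5c · lead-1 g12; plan-1 A-KF v1 §3.2 / R-F15b (6) «IsCentreChart for the NEXT centre on a producer chart: coordinate stratum ⇒ regular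
sequence / regular quotient free; filtration test; trace/Veronese bookkeeping», R-F15c (I-2 := MT-a1″: moves 2 and 3 live on producer charts whose nodes
have FREE models, X-CERT v1 §1.1)] — NOT statements of the manuscript; counted 0; AI-level work, weaker than expert review. Crux
stmt-ResolutionOfSingularities-17941 `CyclicQuotientFourfolds`, line `s1a-logminvertex` v13 (`stub_reachLowerInFX`).

The badness-free MOVE producer for the SECOND and later moves of a tree. `exists_isAdmissibleCentre_of_chartData` (✓p663025) handles a centre in the ring
of SECTIONS of a chart with the trivial node; here the chart `W` of a model `M` carries an arbitrary node `DW` (e.g. the pinned node of a producer chart,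
✓p661308) together with a ring isomorphism `Φ : DW.B ≃ k[T_ι][1/h]` onto a localised polynomial ring (its FREE MODEL, ✓p664843 `a1ModelEquiv` +
✓p664394 `chartRingEquivAway`), and the next centre is a family of distinct VARIABLES `T_{v i}` (homogeneous for the transported grading, with weights
`w`, `σ`-adapted):
* `ModelNode.isRegular_algebraMap_X_away`, `isRegularRing_quotient_X_away` — K1′ for distinct variables in `k[T_ι][1/h]` (given a point of `V(T_v)` where
  `h ≠ 0`), generalising ✓p671712 to any number of variables;
* ★★ `GameFrame.GModel.exists_isAdmissibleCentre_of_modelNode` — if moreover the zero sets on `W` of the traces are CLOSED in `M.V` (hypothesis `hcl`,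
  discharged in instances by the chart-transition lemma ✓`…S1aChartTransition`), then for the transported node `DW.map Φ` (✓p662550) there are a Veronese
  degree `d` and an ADMISSIBLE `G`-stable centre `𝒦` on `M` with `W` a centre chart, `(𝒦|W)_n = e_L⁻¹(trace 𝒥ₙ(T_v, w))` and `supp 𝒦_d ⊆ W` — exactly the
  inputs of `exists_nodeData_blowupChart_pin` / `exists_moveAtlas_of_nodeData` for the move's producer charts.
-/

set_option linter.dupNamespace false

noncomputable section

open CategoryTheory Limits AlgebraicGeometry TopologicalSpace Topology Opposite
open Literature.AlgebraicGeometry.Resolution Literature.AlgebraicGeometry.RelativeSpec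
open MvPolynomial
open Summit.ResolutionOfSingularities.ResolutionOfSingularities.Theorems.WildQuotientResolution.S1
open Summit.ResolutionOfSingularities.ResolutionOfSingularities.Theorems.WildQuotientResolution.S1.NodeAtlas
open Summit.ResolutionOfSingularities.ResolutionOfSingularities.Theorems.WildQuotientResolution.S1.ProducerStep
open Summit.ResolutionOfSingularities.ResolutionOfSingularities.Theorems.WildQuotientResolution.S1.CoarseChart
open Summit.ResolutionOfSingularities.ResolutionOfSingularities.Theorems.WildQuotientResolution.S1.ChartData
open Summit.ResolutionOfSingularities.ResolutionOfSingularities.Theorems.WildQuotientResolution.S1.GoodCharts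
open Summit.ResolutionOfSingularities.ResolutionOfSingularities.Theorems.WildQuotientResolution.S1.KillableTransport
open Summit.ResolutionOfSingularities.ResolutionOfSingularities.Theorems.WildQuotientResolution.S1.NodeTransport
open Summit.ResolutionOfSingularities.ResolutionOfSingularities.Theorems.WildQuotientResolution.S1.NpFrame

/-! ## K1′ for distinct variables in a localised polynomial ring -/

namespace Summit.ResolutionOfSingularities.ResolutionOfSingularities.Theorems.WildQuotientResolution.S1.ModelNode

variable (k : Type) [Field k] {ι : Type}

/-- `List.ofFn (φ T_{v ·}) = ((List.ofFn v).map X).map φ`. -/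
theorem ofFn_algebraMap_X (hh : MvPolynomial ι k) {c : ℕ} (v : Fin c → ι) :
    List.ofFn (fun i => algebraMap (MvPolynomial ι k) (Localization.Away hh) (X (v i))) =
      (((List.ofFn v).map (X : ι → MvPolynomial ι k)).map (algebraMap (MvPolynomial ι k) (Localization.Away hh))) := by
  rw [List.map_ofFn, List.map_ofFn]
  rfl

/-- The span of the images of the `T_{v i}` in `P[1/h]` is the extension of `span (X '' range v)`. -/
theorem span_range_algebraMap_X_eq_map (hh : MvPolynomial ι k) {c : ℕ} (v : Fin c → ι) :
    Ideal.span (Set.range fun i => algebraMap (MvPolynomial ι k) (Localization.Away hh) (X (v i))) =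
      (Ideal.span (X '' Set.range v : Set (MvPolynomial ι k))).map (algebraMap (MvPolynomial ι k) (Localization.Away hh)) := by
  rw [Ideal.map_span]
  congr 1
  ext z
  simp only [Set.mem_range, Set.mem_image]
  constructor
  · rintro ⟨i, rfl⟩
    exact ⟨X (v i), ⟨v i, ⟨i, rfl⟩, rfl⟩, rfl⟩
  · rintro ⟨_, ⟨_, ⟨i, rfl⟩, rfl⟩, rfl⟩
    exact ⟨i, rfl⟩

/-- ★ **Distinct variables stay a regular sequence in `P[1/h]`** whenever `h` does not vanish at some point of `V(T_v)`. [OURS · L1 W4.5c; folklore] -/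
theorem isRegular_algebraMap_X_away (hh : MvPolynomial ι k) {c : ℕ} (v : Fin c → ι) (hv : Function.Injective v) (g : ι → k)
    (hg : ∀ i, g (v i) = 0) (hu : MvPolynomial.eval g hh ≠ 0) :
    RingTheory.Sequence.IsRegular (Localization.Away hh) (List.ofFn fun i => algebraMap (MvPolynomial ι k) (Localization.Away hh) (X (v i))) := by
  haveI : Module.Flat (MvPolynomial ι k) (Localization.Away hh) := IsLocalization.flat (Localization.Away hh) (Submonoid.powers hh)
  rw [ofFn_algebraMap_X]
  refine ⟨(isWeaklyRegular_map_X (R := k) (List.ofFn v) (List.nodup_ofFn.mpr hv)).of_flat, ?_⟩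
  intro htop
  rw [smul_eq_mul, Ideal.mul_top] at htop
  set φ : Localization.Away hh →+* k := IsLocalization.Away.lift hh (g := MvPolynomial.eval g) (Ne.isUnit hu) with hφ
  have hle : Ideal.ofList ((((List.ofFn v).map (X : ι → MvPolynomial ι k)).map (algebraMap (MvPolynomial ι k) (Localization.Away hh)))) ≤
      RingHom.ker φ := by
    rw [Ideal.ofList, Ideal.span_le]
    intro z hz
    rw [Set.mem_setOf_eq, List.mem_map] at hz
    obtain ⟨y, hy, rfl⟩ := hz
    rw [List.mem_map] at hy
    obtain ⟨j, hj, rfl⟩ := hy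
    rw [List.mem_ofFn] at hj
    obtain ⟨i, rfl⟩ := hj
    rw [SetLike.mem_coe, RingHom.mem_ker, hφ, IsLocalization.Away.lift_eq, MvPolynomial.eval_X, hg]
  have h1 : (1 : Localization.Away hh) ∈ Ideal.ofList ((((List.ofFn v).map (X : ι → MvPolynomial ι k)).map
      (algebraMap (MvPolynomial ι k) (Localization.Away hh)))) := by
    rw [← htop]; trivial
  have := hle h1
  rw [RingHom.mem_ker, map_one] at this
  exact one_ne_zero this

/-- ★ **`P[1/h] ⧸ (T_v)` is a regular ring**: a localisation of the polynomial ring `P ⧸ (T_v) ≅ k[T_l : l ∉ range v]`. [OURS · L1 W4.5c; folklore] -/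
theorem isRegularRing_quotient_X_away [Finite ι] (hh : MvPolynomial ι k) {c : ℕ} (v : Fin c → ι) :
    IsRegularRing (Localization.Away hh ⧸ Ideal.span (Set.range fun i => algebraMap (MvPolynomial ι k) (Localization.Away hh) (X (v i)))) := by
  rw [span_range_algebraMap_X_eq_map]
  haveI : IsRegularRing (MvPolynomial {l : ι // l ∉ Set.range v} k) := inferInstance
  haveI : IsRegularRing (MvPolynomial ι k ⧸ Ideal.span (X '' Set.range v : Set (MvPolynomial ι k))) :=
    IsRegularRing.of_ringEquiv (quotientSpanXEquiv (R := k) (Set.range v)).toRingEquiv.symm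
  exact isRegularRing_of_isLocalization (A := MvPolynomial ι k ⧸ Ideal.span (X '' Set.range v : Set (MvPolynomial ι k)))
    (Algebra.algebraMapSubmonoid (MvPolynomial ι k ⧸ Ideal.span (X '' Set.range v : Set (MvPolynomial ι k))) (Submonoid.powers hh))
    (Localization.Away hh ⧸ (Ideal.span (X '' Set.range v : Set (MvPolynomial ι k))).map (algebraMap (MvPolynomial ι k) (Localization.Away hh)))

end Summit.ResolutionOfSingularities.ResolutionOfSingularities.Theorems.WildQuotientResolution.S1.ModelNode

/-! ## The move producer on a model node -/

namespace Summit.ResolutionOfSingularities.ResolutionOfSingularities.Theorems.WildQuotientResolution.S1.GameFrame.GModel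

open ModelNode

variable {p : ℕ} {X' X₁ : Scheme.{0}} {q : X' ⟶ X₁} {G : Type} [Group G] {ρ : G →* Aut X'} {g₀ : G}

/-- ★★ **AN ADMISSIBLE CENTRE CUT OUT BY VARIABLES OF A FREE MODEL OF A CHART'S NODE.** `M` a separated model (`G = ⟨g₀⟩` finite), `W` a stable affine chart
with node `DW` and a model `Φ : DW.B ≃ k[T_ι][1/h]`; the next centre is the family of distinct variables `T_{v i}` (`c > 0` of them), homogeneous of
degrees `δ` for the transported grading, with weights `w > 0`, `σ`-adapted (`hσJ`), missing the locus `h = 0` at some point `g` (`hg`, `hu`), and with the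
zero sets on `W` of the traces `e_L⁻¹(trace 𝒥ₙ)` CLOSED in `M.V` (`hcl`). Then there are a Veronese degree `d > 0` and an ADMISSIBLE centre `𝒦` on `M`
with `W` a centre chart (node `DW.map Φ`), `G`-stable pieces, `(𝒦|W)_n = e_L⁻¹(trace 𝒥ₙ(T_v, w))` and `supp 𝒦_d ⊆ W`.
[OURS · L1 W4.5c · X-scheme MOVE producer for later moves; NOT a statement of the manuscript] -/
theorem exists_isAdmissibleCentre_of_modelNode [Finite G] (hG : ∀ g : G, g ∈ Subgroup.zpowers g₀) (M : GModel p q G ρ g₀) [M.V.IsSeparated]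
    (W : M.act.StableAffineOpens) (DW : NodeData p M.act g₀ W)
    {k : Type} [Field k] {ι : Type} [Finite ι] (hh : MvPolynomial ι k) (Φ : letI := DW.instCommRing; DW.B ≃+* Localization.Away hh)
    {c : ℕ} (hc : 0 < c) (v : Fin c → ι) (hv : Function.Injective v) (δ : Fin c → Π j : Fin DW.m, ZMod (DW.r j)) (w : Fin c → ℕ) (hw : ∀ i, 0 < w i)
    (hdeg : ∀ i, letI := DW.instCommRing; letI := DW.instGradedRing;
      algebraMap (MvPolynomial ι k) (Localization.Away hh) (X (v i)) ∈ mapGrading DW.𝒜 Φ (δ i))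
    (g : ι → k) (hg : ∀ i, g (v i) = 0) (hu : MvPolynomial.eval g hh ≠ 0)
    (hσJ : letI := DW.instCommRing; ∀ n : ℕ,
      ((weightedFiltration (fun i => algebraMap (MvPolynomial ι k) (Localization.Away hh) (X (v i))) w).ideal n).map
          (conj Φ DW.σ : Localization.Away hh →+* Localization.Away hh) ≤
        (weightedFiltration (fun i => algebraMap (MvPolynomial ι k) (Localization.Away hh) (X (v i))) w).ideal n)
    (hcl : letI := DW.instCommRing; letI := DW.instGradedRing; letI := mapGradedRing DW.𝒜 Φ; ∀ n : ℕ, 0 < n →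
      closure (M.V.zeroLocus (U := W.1)
          ((((traceFiltration (mapGrading DW.𝒜 Φ) (fun i => algebraMap (MvPolynomial ι k) (Localization.Away hh) (X (v i))) w).ideal n).comap
              ((DW.e.trans (zeroRingEquiv DW.𝒜 Φ) : Γ(M.V, W.1) ≃+* ↥(mapGrading DW.𝒜 Φ 0)) : Γ(M.V, W.1) →+* ↥(mapGrading DW.𝒜 Φ 0)) :
            Ideal Γ(M.V, W.1)) : Set Γ(M.V, W.1)) ∩ (W.1 : Set M.V)) ⊆ (W.1 : Set M.V)) :
    letI := DW.instCommRing; letI := DW.instGradedRing; letI := mapGradedRing DW.𝒜 Φ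
    ∃ (𝒦 : ReesFiltration M.V) (d : ℕ), 0 < d ∧ IsAdmissibleCentre p M.act g₀ 𝒦 d ∧ IsCentreChart p M.act g₀ 𝒦 d W ∧
      (∀ (g : G) (n : ℕ), (𝒦.ideal n).comap (M.act.aut g).hom = 𝒦.ideal n) ∧
      (∀ n, (𝒦.filtration ⟨W.1, DW.affine⟩).ideal n =
        ((traceFiltration (mapGrading DW.𝒜 Φ) (fun i => algebraMap (MvPolynomial ι k) (Localization.Away hh) (X (v i))) w).ideal n).comap
          ((DW.e.trans (zeroRingEquiv DW.𝒜 Φ) : Γ(M.V, W.1) ≃+* ↥(mapGrading DW.𝒜 Φ 0)) : Γ(M.V, W.1) →+* ↥(mapGrading DW.𝒜 Φ 0))) ∧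
      VeroneseNormalised (mapGrading DW.𝒜 Φ) (fun i => algebraMap (MvPolynomial ι k) (Localization.Away hh) (X (v i))) w d ∧
      (((𝒦.ideal d).support : Set M.V)) ⊆ (W.1 : Set M.V) := by
  classical
  letI := DW.instCommRing
  letI := DW.instGradedRing
  letI := mapGradedRing DW.𝒜 Φ
  haveI : IsLocallyNoetherian M.V := M.isLocallyNoetherian
  set L := Localization.Away hh with hL
  set f : Fin c → Localization.Away hh := fun i => algebraMap (MvPolynomial ι k) (Localization.Away hh) (X (v i)) with hfdef
  set eL : Γ(M.V, W.1) ≃+* ↥(mapGrading DW.𝒜 Φ 0) := DW.e.trans (zeroRingEquiv DW.𝒜 Φ) with heL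
  -- the transported node
  have htame : IsTameNode p (Localization.Away hh) (mapGrading DW.𝒜 Φ) (conj Φ DW.σ) := isTameNode_map DW.𝒜 Φ p DW.σ DW.tame
  have hσ : ∀ t : Γ(M.V, W.1), ((eL ((M.act.aut g₀⁻¹).hom.appLE W.1 W.1 (W.2.1 g₀⁻¹).ge t) : ↥(mapGrading DW.𝒜 Φ 0)) : Localization.Away hh) =
      conj Φ DW.σ ((eL t : ↥(mapGrading DW.𝒜 Φ 0)) : Localization.Away hh) := fun t => by
    change Φ ((DW.e (actO M.act W g₀ t) : ↥(DW.𝒜 0)) : DW.B) = Φ (DW.σ (Φ.symm (Φ ((DW.e t : ↥(DW.𝒜 0)) : DW.B))))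
    rw [DW.intertwine t, Φ.symm_apply_apply]
  -- K1′
  have hK1 : RingTheory.Sequence.IsRegular (Localization.Away hh) (List.ofFn f) := isRegular_algebraMap_X_away k hh v hv g hg hu
  have hK1' : IsRegularRing (Localization.Away hh ⧸ Ideal.span (Set.range f)) := isRegularRing_quotient_X_away k hh v
  -- a Veronese degree
  obtain ⟨d, hver⟩ : ∃ d : ℕ, VeroneseNormalised (mapGrading DW.𝒜 Φ) f w d :=
    Veronese.veroneseNormalisation _ _ (mapGrading DW.𝒜 Φ) htame.2.2.2.1 c f δ w hdeg
  have hdpos : 0 < d := hver.1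
  -- the chart filtration and its trace
  let K : IdealFiltration Γ(M.V, W.1) := (traceFiltration (mapGrading DW.𝒜 Φ) f w).comap (eL : Γ(M.V, W.1) →+* ↥(mapGrading DW.𝒜 Φ 0))
  let 𝒦₀ : ReesFiltration M.V := chartFiltration W.1 K
  have h𝒦O : ∀ n, (𝒦₀.filtration ⟨W.1, DW.affine⟩).ideal n =
      ((traceFiltration (mapGrading DW.𝒜 Φ) f w).ideal n).comap (eL : Γ(M.V, W.1) →+* ↥(mapGrading DW.𝒜 Φ 0)) := fun n => by
    rw [filtration_chartFiltration W.1 DW.affine K n]; rfl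
  have hcentre : IsCentreChart p M.act g₀ 𝒦₀ d W :=
    ⟨DW.affine, DW.m, DW.r, Localization.Away hh, inferInstance, mapGrading DW.𝒜 Φ, inferInstance, conj Φ DW.σ, eL, htame, hσ, c, f, δ, w, hc, hdeg, hw,
      hK1, hK1', hσJ, h𝒦O, hver⟩
  -- closedness of the support on the chart
  have hsupp : (((𝒦₀.ideal d).support : Set M.V)) = closure (M.V.zeroLocus (U := W.1) ((K.ideal d : Ideal Γ(M.V, W.1)) : Set Γ(M.V, W.1)) ∩ (W.1 : Set M.V)) :=
    support_chartFiltration W.1 DW.affine K d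
  have hclW : closure (M.V.zeroLocus (U := W.1) ((K.ideal d : Ideal Γ(M.V, W.1)) : Set Γ(M.V, W.1)) ∩ (W.1 : Set M.V)) ⊆ (W.1 : Set M.V) := hcl d hdpos
  have hcl' : ∀ _ : Unit, closure ((((𝒦₀.ideal d).support : Set M.V)) ∩ (W.1 : Set M.V)) ⊆ ⋃ _ : Unit, (W.1 : Set M.V) := fun _ => by
    rw [Set.iUnion_const, hsupp]
    refine (closure_mono Set.inter_subset_left).trans ?_
    rw [closure_closure]
    exact hclW
  obtain ⟨J, hJadm, hJO, hJG, hJfil, hJsub, -⟩ := exists_isAdmissibleCentre_of_charts hG M (fun _ : Unit => W) (fun _ => 𝒦₀) hdpos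
    (fun _ => hcentre) (fun _ _ _ _ _ _ => rfl) hcl'
  refine ⟨J, d, hdpos, hJadm, hJO (), hJG, fun n => by rw [hJfil () DW.affine n, h𝒦O], hver, hJsub.trans ?_⟩
  rw [Set.iUnion_const, hsupp]
  refine (closure_mono Set.inter_subset_left).trans ?_
  rw [closure_closure]
  exact hclW

end Summit.ResolutionOfSingularities.ResolutionOfSingularities.Theorems.WildQuotientResolution.S1.GameFrame.GModel

end
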